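import Summits.NavierStokesRegularity.NavierStokesRegularity.Theorems.ExtremiserTransienceNearExtremalTransienceExtremiserLiouvilleConstantSpeedSlideQuotientLimit
import HarnessLib

/-!
# Crux `ExtremiserTransience.NearExtremalTransience` (stmt-NavierStokesRegularity-21883), line `extremiser_liouville`,
# stub K1b — `D curl φ̂_h` as a three-piece difference (record §13, R2′)

`--supports stmt-NavierStokesRegularity-21883` (helper).  Author: prover seat `ns-el-k1b` (g8).
With `Ψ = g(x₂)V`, `G = g′(x₂)V₂`, `Kⱼ = ∂ⱼG`, `F_h = ∫_{−h}^{0}G(·+te₂)dt`, `φ̂_h = Ψ − Ψ(·−he₂) − F_h e₂`: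
* `curl_smul_single_two` : `curl(F e₂)(x) = ∂₁F(x)·e₀ − ∂₀F(x)·e₁`;
* `curl_slideQuotient_eq'` : `curl φ̂_h = curl Ψ − curl Ψ(·−he₂) − [(∫K₁(·+te₂))e₀ − (∫K₀(·+te₂))e₁]` (as functions);
* `fderiv_curl_slideQuotient_apply` : **`D(curl φ̂_h)(x)v = D(curl Ψ)(x)v − D(curl Ψ)(x−he₂)v − [(∫DK₁(x+te₂)v dt)e₀ − (∫DK₀(x+te₂)v dt)e₁]`**
  — only `DG, D²G` (i.e. `V, DV, D²V` on the layer) and translates of `D curl Ψ = gDω + R` occur; this is the input of the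
  palinstrophy bound R3′ (shifted discrete product rule p728345 on the `gDω` part).

WHAT THIS IS NOT: K1b is NOT proved; nothing here proves NS regularity. [folklore]
-/

noncomputable section

open Set Filter Topology MeasureTheory Metric Function InnerProductSpace
open scoped ENNReal NNReal Topology InnerProductSpace RealInnerProductSpace ContDiff
open Literature.Analysis.FluidPDE Literature.Analysis

namespace Summit.NavierStokesRegularity.NavierStokesRegularity.Theorems

-- the problem directory repeats the summit name (`NavierStokesRegularity/NavierStokesRegularity`)
set_option linter.dupNamespace false

namespace ExtremiserLiouville

open DepletionLadder.KStar

variable {V : EuclideanSpace ℝ (Fin 3) → EuclideanSpace ℝ (Fin 3)} {g : ℝ → ℝ} {F : EuclideanSpace ℝ (Fin 3) → ℝ}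

/-- **`curl(F e₂)(x) = ∂₁F(x)·e₀ − ∂₀F(x)·e₁`** for a differentiable scalar `F`. [folklore] -/
theorem curl_smul_single_two {x : EuclideanSpace ℝ (Fin 3)} (hF : DifferentiableAt ℝ F x) :
    curl (fun y : EuclideanSpace ℝ (Fin 3) => F y • EuclideanSpace.single (2 : Fin 3) (1 : ℝ)) x =
      (fderiv ℝ F x (EuclideanSpace.single (1 : Fin 3) (1 : ℝ))) • EuclideanSpace.single (0 : Fin 3) (1 : ℝ) -
        (fderiv ℝ F x (EuclideanSpace.single (0 : Fin 3) (1 : ℝ))) • EuclideanSpace.single (1 : Fin 3) (1 : ℝ) := by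
  have hD : fderiv ℝ (fun y : EuclideanSpace ℝ (Fin 3) => F y • EuclideanSpace.single (2 : Fin 3) (1 : ℝ)) x =
      (fderiv ℝ F x).smulRight (EuclideanSpace.single (2 : Fin 3) (1 : ℝ)) := fderiv_smul_const hF _
  ext i
  fin_cases i <;>
  · simp only [curl]
    rw [hD]
    simp

/-- **`curl φ̂_h = curl Ψ − curl Ψ(·−he₂) − [(∫K₁(·+te₂)dt)e₀ − (∫K₀(·+te₂)dt)e₁]`** as functions
(`Ψ = g(x₂)V`, `Kⱼ = ∂ⱼ(g′(x₂)V₂)`). [folklore] -/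
theorem curl_slideQuotient_eq' (hV : ContDiff ℝ ∞ V) (hg : ContDiff ℝ ∞ g) (h : ℝ) :
    curl (fun x : EuclideanSpace ℝ (Fin 3) =>
        g (x 2) • V x - g ((x + (-h) • EuclideanSpace.single (2 : Fin 3) (1 : ℝ)) 2) •
            V (x + (-h) • EuclideanSpace.single (2 : Fin 3) (1 : ℝ)) -
          (∫ t in (-h)..0, deriv g ((x + t • EuclideanSpace.single (2 : Fin 3) (1 : ℝ)) 2) *
              V (x + t • EuclideanSpace.single (2 : Fin 3) (1 : ℝ)) 2) • EuclideanSpace.single (2 : Fin 3) (1 : ℝ)) =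
      fun x => curl (fun z : EuclideanSpace ℝ (Fin 3) => g (z 2) • V z) x -
        curl (fun z : EuclideanSpace ℝ (Fin 3) => g (z 2) • V z) (x + (-h) • EuclideanSpace.single (2 : Fin 3) (1 : ℝ)) -
        ((∫ t in (-h)..0, fderiv ℝ (fun z : EuclideanSpace ℝ (Fin 3) => deriv g (z 2) * V z 2)
            (x + t • EuclideanSpace.single (2 : Fin 3) (1 : ℝ)) (EuclideanSpace.single (1 : Fin 3) (1 : ℝ))) •
            EuclideanSpace.single (0 : Fin 3) (1 : ℝ) -
          (∫ t in (-h)..0, fderiv ℝ (fun z : EuclideanSpace ℝ (Fin 3) => deriv g (z 2) * V z 2)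
            (x + t • EuclideanSpace.single (2 : Fin 3) (1 : ℝ)) (EuclideanSpace.single (0 : Fin 3) (1 : ℝ))) •
            EuclideanSpace.single (1 : Fin 3) (1 : ℝ)) := by
  set e₂ : EuclideanSpace ℝ (Fin 3) := EuclideanSpace.single (2 : Fin 3) (1 : ℝ) with he₂
  set Ψ : EuclideanSpace ℝ (Fin 3) → EuclideanSpace ℝ (Fin 3) := fun z => g (z 2) • V z with hΨ
  set G : EuclideanSpace ℝ (Fin 3) → ℝ := fun z => deriv g (z 2) * V z 2 with hG
  set Fh : EuclideanSpace ℝ (Fin 3) → ℝ := fun y => ∫ t in (-h)..0, G (y + t • e₂) with hFh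
  have hVd : Differentiable ℝ V := hV.differentiable (by simp)
  have hgd : Differentiable ℝ g := hg.differentiable (by simp)
  have hproj : ContDiff ℝ ∞ fun y : EuclideanSpace ℝ (Fin 3) => y 2 :=
    (EuclideanSpace.proj (2 : Fin 3) : EuclideanSpace ℝ (Fin 3) →L[ℝ] ℝ).contDiff
  have hγ : ContDiff ℝ ∞ (deriv g) := (contDiff_infty_iff_deriv.mp hg).2
  have hGs : ContDiff ℝ ∞ G := (hγ.comp hproj).mul (hproj.comp hV)
  have hG1 : ContDiff ℝ 1 G := hGs.of_le (WithTop.coe_le_coe.mpr le_top)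
  have hΨd : Differentiable ℝ Ψ := fun y => (hasFDerivAt_axialWeight_smul hVd hgd y).differentiableAt
  have hΨad : Differentiable ℝ fun y => Ψ (y + (-h) • e₂) := hΨd.comp (differentiable_id.add_const _)
  have hFd : Differentiable ℝ Fh := differentiable_verticalIntegral hG1 (-h) 0
  have hFe : Differentiable ℝ fun y => Fh y • e₂ := hFd.smul_const e₂
  funext x
  have hfun : (fun y : EuclideanSpace ℝ (Fin 3) => g (y 2) • V y - g ((y + (-h) • e₂) 2) • V (y + (-h) • e₂) -
      (∫ t in (-h)..0, deriv g ((y + t • e₂) 2) * V (y + t • e₂) 2) • e₂) =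
      fun y => Ψ y - Ψ (y + (-h) • e₂) - Fh y • e₂ := rfl
  -- linearity of `curl` and translation
  have h1 : curl (fun y => Ψ y - Ψ (y + (-h) • e₂) - Fh y • e₂) x =
      curl Ψ x - curl Ψ (x + (-h) • e₂) - curl (fun y => Fh y • e₂) x := by
    have hΨΨad : Differentiable ℝ fun y => Ψ y - Ψ (y + (-h) • e₂) := hΨd.sub hΨad
    rw [curl_eq_curlCLM, curl_eq_curlCLM, curl_eq_curlCLM, curl_eq_curlCLM,
      fderiv_fun_sub (hΨΨad x) (hFe x), fderiv_fun_sub (hΨd x) (hΨad x), fderiv_comp_add_right,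
      map_sub, map_sub]
  rw [hfun, h1, curl_smul_single_two (hFd x)]
  -- the two horizontal derivatives of the sliding integral
  have hcont : Continuous fun t : ℝ => fderiv ℝ G (x + t • e₂) :=
    (hGs.continuous_fderiv (by simp)).comp (continuous_const.add (continuous_id.smul continuous_const))
  have hD : ∀ w : EuclideanSpace ℝ (Fin 3), fderiv ℝ Fh x w = ∫ t in (-h)..0, fderiv ℝ G (x + t • e₂) w := by
    intro w
    simp only [hFh]
    rw [fderiv_verticalIntegral_eq hG1 (-h) 0 x]
    exact ContinuousLinearMap.intervalIntegral_apply (hcont.intervalIntegrable _ _) w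
  rw [hD, hD]

/-- **`D(curl φ̂_h)(x)v = D(curl Ψ)(x)v − D(curl Ψ)(x−he₂)v − [(∫_{−h}^0 DK₁(x+te₂)v dt)e₀ − (∫_{−h}^0 DK₀(x+te₂)v dt)e₁]`**,
`Ψ = g(x₂)V`, `Kⱼ = ∂ⱼ(g′(x₂)V₂)` (only `V, DV, D²V`). [folklore] -/
theorem fderiv_curl_slideQuotient_apply (hV : ContDiff ℝ ∞ V) (hg : ContDiff ℝ ∞ g) (h : ℝ) (x v : EuclideanSpace ℝ (Fin 3)) :
    fderiv ℝ (curl (fun x : EuclideanSpace ℝ (Fin 3) =>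
        g (x 2) • V x - g ((x + (-h) • EuclideanSpace.single (2 : Fin 3) (1 : ℝ)) 2) •
            V (x + (-h) • EuclideanSpace.single (2 : Fin 3) (1 : ℝ)) -
          (∫ t in (-h)..0, deriv g ((x + t • EuclideanSpace.single (2 : Fin 3) (1 : ℝ)) 2) *
              V (x + t • EuclideanSpace.single (2 : Fin 3) (1 : ℝ)) 2) • EuclideanSpace.single (2 : Fin 3) (1 : ℝ))) x v =
      fderiv ℝ (curl (fun z : EuclideanSpace ℝ (Fin 3) => g (z 2) • V z)) x v -
        fderiv ℝ (curl (fun z : EuclideanSpace ℝ (Fin 3) => g (z 2) • V z)) (x + (-h) • EuclideanSpace.single (2 : Fin 3) (1 : ℝ)) v -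
        ((∫ t in (-h)..0, fderiv ℝ (fun y : EuclideanSpace ℝ (Fin 3) => fderiv ℝ (fun z : EuclideanSpace ℝ (Fin 3) => deriv g (z 2) * V z 2) y (EuclideanSpace.single (1 : Fin 3) (1 : ℝ)))
            (x + t • EuclideanSpace.single (2 : Fin 3) (1 : ℝ)) v) • EuclideanSpace.single (0 : Fin 3) (1 : ℝ) -
          (∫ t in (-h)..0, fderiv ℝ (fun y : EuclideanSpace ℝ (Fin 3) => fderiv ℝ (fun z : EuclideanSpace ℝ (Fin 3) => deriv g (z 2) * V z 2) y (EuclideanSpace.single (0 : Fin 3) (1 : ℝ)))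
            (x + t • EuclideanSpace.single (2 : Fin 3) (1 : ℝ)) v) • EuclideanSpace.single (1 : Fin 3) (1 : ℝ)) := by
  set e₂ : EuclideanSpace ℝ (Fin 3) := EuclideanSpace.single (2 : Fin 3) (1 : ℝ) with he₂
  set e₁ : EuclideanSpace ℝ (Fin 3) := EuclideanSpace.single (1 : Fin 3) (1 : ℝ) with he₁
  set e₀ : EuclideanSpace ℝ (Fin 3) := EuclideanSpace.single (0 : Fin 3) (1 : ℝ) with he₀
  set Ψ : EuclideanSpace ℝ (Fin 3) → EuclideanSpace ℝ (Fin 3) := fun z => g (z 2) • V z with hΨ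
  set G : EuclideanSpace ℝ (Fin 3) → ℝ := fun z => deriv g (z 2) * V z 2 with hG
  set K₁ : EuclideanSpace ℝ (Fin 3) → ℝ := fun y => fderiv ℝ G y e₁ with hK₁
  set K₀ : EuclideanSpace ℝ (Fin 3) → ℝ := fun y => fderiv ℝ G y e₀ with hK₀
  set I₁ : EuclideanSpace ℝ (Fin 3) → ℝ := fun y => ∫ t in (-h)..0, K₁ (y + t • e₂) with hI₁
  set I₀ : EuclideanSpace ℝ (Fin 3) → ℝ := fun y => ∫ t in (-h)..0, K₀ (y + t • e₂) with hI₀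
  have hproj : ContDiff ℝ ∞ fun y : EuclideanSpace ℝ (Fin 3) => y 2 :=
    (EuclideanSpace.proj (2 : Fin 3) : EuclideanSpace ℝ (Fin 3) →L[ℝ] ℝ).contDiff
  have hΨs : ContDiff ℝ ∞ Ψ := (hg.comp hproj).smul hV
  have hγ : ContDiff ℝ ∞ (deriv g) := (contDiff_infty_iff_deriv.mp hg).2
  have hGs : ContDiff ℝ ∞ G := (hγ.comp hproj).mul (hproj.comp hV)
  have hDGs : ContDiff ℝ ∞ (fderiv ℝ G) := hGs.fderiv_right (m := ∞) (by exact_mod_cast le_rfl)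
  have hK₁s : ContDiff ℝ 1 K₁ := (hDGs.clm_apply contDiff_const).of_le (WithTop.coe_le_coe.mpr le_top)
  have hK₀s : ContDiff ℝ 1 K₀ := (hDGs.clm_apply contDiff_const).of_le (WithTop.coe_le_coe.mpr le_top)
  have hωΨd : Differentiable ℝ (curl Ψ) := (contDiff_curl (n := 1) (hΨs.of_le (WithTop.coe_le_coe.mpr le_top))).differentiable
    one_ne_zero
  have hωΨad : Differentiable ℝ fun y => curl Ψ (y + (-h) • e₂) := hωΨd.comp (differentiable_id.add_const _)
  have hI₁d : Differentiable ℝ I₁ := differentiable_verticalIntegral hK₁s (-h) 0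
  have hI₀d : Differentiable ℝ I₀ := differentiable_verticalIntegral hK₀s (-h) 0
  rw [curl_slideQuotient_eq' hV hg h]
  have hfun : (fun x => curl Ψ x - curl Ψ (x + (-h) • e₂) - ((∫ t in (-h)..0, fderiv ℝ G (x + t • e₂) e₁) • e₀ -
      (∫ t in (-h)..0, fderiv ℝ G (x + t • e₂) e₀) • e₁)) = fun x => curl Ψ x - curl Ψ (x + (-h) • e₂) - (I₁ x • e₀ - I₀ x • e₁) := rfl
  rw [hfun]
  have hAd : Differentiable ℝ fun y => curl Ψ y - curl Ψ (y + (-h) • e₂) := hωΨd.sub hωΨad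
  have hBd : Differentiable ℝ fun y => I₁ y • e₀ - I₀ y • e₁ := (hI₁d.smul_const e₀).sub (hI₀d.smul_const e₁)
  rw [fderiv_fun_sub (hAd x) (hBd x), fderiv_fun_sub (hωΨd x) (hωΨad x), fderiv_comp_add_right,
    fderiv_fun_sub ((hI₁d x).smul_const e₀) ((hI₀d x).smul_const e₁), fderiv_smul_const (hI₁d x), fderiv_smul_const (hI₀d x)]
  simp only [sub_apply, ContinuousLinearMap.smulRight_apply]
  have c₁ : Continuous fun t : ℝ => fderiv ℝ K₁ (x + t • e₂) :=
    (hK₁s.continuous_fderiv one_ne_zero).comp (continuous_const.add (continuous_id.smul continuous_const))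
  have c₀ : Continuous fun t : ℝ => fderiv ℝ K₀ (x + t • e₂) :=
    (hK₀s.continuous_fderiv one_ne_zero).comp (continuous_const.add (continuous_id.smul continuous_const))
  have hD₁ : fderiv ℝ I₁ x v = ∫ t in (-h)..0, fderiv ℝ K₁ (x + t • e₂) v := by
    simp only [hI₁]
    rw [fderiv_verticalIntegral_eq hK₁s (-h) 0 x]
    exact ContinuousLinearMap.intervalIntegral_apply (c₁.intervalIntegrable _ _) v
  have hD₀ : fderiv ℝ I₀ x v = ∫ t in (-h)..0, fderiv ℝ K₀ (x + t • e₂) v := by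
    simp only [hI₀]
    rw [fderiv_verticalIntegral_eq hK₀s (-h) 0 x]
    exact ContinuousLinearMap.intervalIntegral_apply (c₀.intervalIntegrable _ _) v
  rw [hD₁, hD₀]

end ExtremiserLiouville

end Summit.NavierStokesRegularity.NavierStokesRegularity.Theorems

end
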